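import Summits.CriticalPhenomena.PercolationContinuityZ3.Theorems.SahiMasterFamilyWeightSum
import Summits.CriticalPhenomena.PercolationContinuityZ3.Theorems.SahiMasterFamilyPointwiseCoordinateGluing
import Summits.CriticalPhenomena.PercolationContinuityZ3.Theorems.SahiMasterFamilyTerminalAll

/-!
# The one-coordinate expansion of `E_k(μ_p; 1_U)` around a SECTION, every order, with nonnegative transferable coefficients

Unit `prim-master-conj` (crux anchor stmt-CriticalPhenomena-4575, helper work), gen 16; memo
`run/shared/lean/prim/prim-l12/prim-master-conj/POINTWISE.md` §17.  Companion of `…WeightSum` (the engine) and `…PinningAllOrders` (the use).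

Fix a product measure `μ_p` on `2^ι`, a coordinate `e` with `t = p_e`, and write `X¹ = secAt e true X` for the `1`-section.  The product weight splits as
`μ_p = σ + μ_{p[e↦1]}` with the SIGNED weight `σ := μ_p − μ_{p[e↦1]}` (mass `0`; it is `(1−t)·μ'` on `{e ∉ ω}` and `−(1−t)·μ'` on `{e ∈ ω}`),
and `E_k(μ_{p[e↦1]}; 1_U) = E_k(μ_p; 1_{U¹})` (the tree's `sahiE_update_boolParam_eq_secAt`).  The all-orders identity of `…WeightSum` therefore gives
the **section expansion** (`sahiE_ind_section_expansion`): for every family `U = (U_0,…,U_{n−1})` of events,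

  `E_n(μ_p; 1_U) = E_n(μ_p; 1_{U¹}) − W_p(U) + Σ_{A} W_p(U_A) · E_{n−|A|}(μ_p; 1_{(U¹)_{Aᶜ}})`,   `W_p(V) := −E^{σ}(1_V)`

(sum over all sets of slots `A`; the extreme terms vanish, `E_0 = 0`).  The coefficients `W_p(V) = −E_{|V|}(μ_p − μ_{p[e↦1]}; 1_V)` are Sahi
functionals of a signed weight, so they obey the Lieb–Sahi recursion; for INCREASING events this recursion has all signs plus
(`ex` of the signed weight is `−(1−t)·(μ_p(X¹) − μ_p(X⁰)) ≤ 0`), whence (`sectionW_nonneg`) **`W_p(V) ≥ 0`** and (`sectionW_eq_zero_transfer`)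
**a zero of `W_p(V)` at one interior `p` is a zero at every `q`**.  Closed form (not needed, not formalised): `W_p(V) = Σ_{π ∈ Part} (1−t)^{|π|}
Π_{B∈π} (|B|−1)!·(μ_p(⋂_B V¹) − μ_p(⋂_B V⁰))` — the coefficients of `exp((1−t)·L)`, `L = log G(V⁰) − log G(V¹) ≥ 0`.
HONEST FRAMING: identities and sign bookkeeping; nothing is claimed about `C_k` / `MasterFamilyEqIff k` in general.  Axioms standard. [this work]
-/

noncomputable section

open scoped Classical

namespace Summit.CriticalPhenomena.PercolationContinuityZ3.Theorems

open Finset Function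
open Literature.Combinatorics.Sahi2008
open Literature.Probability.Percolation.DecisionTree (ind ind_of_mem ind_of_not_mem ind_nonneg)

namespace Pinning

variable {ι : Type} [Fintype ι]

/-! ### The signed weight `σ = μ_p − μ_{p[e↦1]}` and the boundary weight `μ_{p[e↦1]}` -/

/-- `boolParam true = 1`. [folklore] -/
theorem boolParam_true : boolParam true = 1 := by simp [boolParam]

/-- `E` under a difference of weights. [folklore] -/
theorem ex_sub_weight (μ₁ μ₂ : Set ι → ℝ) (f : Set ι → ℝ) : ex (μ₁ - μ₂) f = ex μ₁ f - ex μ₂ f := by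
  simp only [ex_def, Pi.sub_apply, sub_mul, Finset.sum_sub_distrib]

/-- At `p_e = 1` the probability of an event is the `μ_p`-probability of its `1`-section. [folklore] -/
theorem ex_ind_update_one (p : ι → unitInterval) (e : ι) (X : Set (Set ι)) :
    ex (bernoulliWeight (update p e 1)) (ind X) = ex (bernoulliWeight p) (ind (secAt e true X)) := by
  rw [← boolParam_true, ex_ind_update_boolParam, ex_ind_secAt_update]

/-- **`E_k` at `p_e = 1` is `E_k(μ_p)` of the `1`-sections**, every order. [this work] -/
theorem sahiE_ind_update_one (p : ι → unitInterval) (e : ι) {k : ℕ} (U : Fin k → Set (Set ι)) :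
    sahiE (bernoulliWeight (update p e 1)) k (fun j => ind (U j)) =
      sahiE (bernoulliWeight p) k (fun j => ind (secAt e true (U j))) := by
  rw [← boolParam_true, sahiE_update_boolParam_eq_secAt, sahiE_secAt_update_eq p e true (boolParam true) (p e), update_eq_self]

/-- **`E` of an indicator under the signed weight**: `E^{σ}(1_X) = −(1 − p_e)·(μ_p(X¹) − μ_p(X⁰))`. [this work] -/
theorem ex_ind_signedWeight (p : ι → unitInterval) (e : ι) (X : Set (Set ι)) :
    ex (bernoulliWeight p - bernoulliWeight (update p e 1)) (ind X) =
      -((1 - (p e : ℝ)) * (ex (bernoulliWeight p) (ind (secAt e true X)) - ex (bernoulliWeight p) (ind (secAt e false X)))) := by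
  rw [ex_sub_weight, ex_ind_update_one, ex_ind_eq_secAt p e X]
  ring

/-- For an increasing event, `E^{σ}(1_X) ≤ 0`. [this work] -/
theorem ex_ind_signedWeight_nonpos (p : ι → unitInterval) (e : ι) {X : Set (Set ι)} (hX : IsUpperSet X) :
    ex (bernoulliWeight p - bernoulliWeight (update p e 1)) (ind X) ≤ 0 := by
  rw [ex_ind_signedWeight]
  exact neg_nonpos.mpr (mul_nonneg (sub_nonneg.mpr (p e).2.2) (Pointwise.ex_secAt_true_sub_false_nonneg p e hX))

/-- Transfer of `E^{σ}(1_X) = 0` from one interior parameter to any other. [this work] -/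
theorem ex_ind_signedWeight_eq_zero_transfer {p : ι → unitInterval} (hp : ∀ i, (p i : ℝ) ∈ Set.Ioo (0 : ℝ) 1) (q : ι → unitInterval)
    (e : ι) {X : Set (Set ι)} (hX : IsUpperSet X) (h : ex (bernoulliWeight p - bernoulliWeight (update p e 1)) (ind X) = 0) :
    ex (bernoulliWeight q - bernoulliWeight (update q e 1)) (ind X) = 0 := by
  rw [ex_ind_signedWeight] at h ⊢
  have ht : (1 - (p e : ℝ)) ≠ 0 := ne_of_gt (sub_pos.mpr (hp e).2)
  have hν := (mul_eq_zero.mp (neg_eq_zero.mp h)).resolve_left ht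
  rw [Pointwise.ex_secAt_sub_eq_zero_transfer hp q e hX hν, mul_zero, neg_zero]

/-! ### Products of indicators inside an update -/

omit [Fintype ι] in
/-- Updating the slot `l` of an indicator family by the product with `1_X` is the indicator family of `update V l (V l ∩ X)`. [folklore] -/
theorem update_ind_mul_ind {k : ℕ} (V : Fin k → Set (Set ι)) (l : Fin k) (X : Set (Set ι)) :
    update (fun j => ind (V j)) l ((fun j => ind (V j)) l * ind X) = fun j => ind (update V l (V l ∩ X) j) := by
  funext j
  by_cases hj : j = l
  · subst hj; rw [update_self, update_self, ind_mul_ind_eq_inter]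
  · rw [update_of_ne hj, update_of_ne hj]

omit [Fintype ι] in
/-- An update of an increasing family by an intersection with an increasing event is increasing. [folklore] -/
theorem isUpperSet_update_inter {k : ℕ} {V : Fin k → Set (Set ι)} (hV : ∀ j, IsUpperSet (V j)) (l : Fin k) {X : Set (Set ι)}
    (hX : IsUpperSet X) (j : Fin k) : IsUpperSet (update V l (V l ∩ X) j) := by
  by_cases hj : j = l
  · subst hj; rw [update_self]; exact (hV j).inter hX
  · rw [update_of_ne hj]; exact hV j

/-! ### `W_p(V) = −E^{σ}(1_V)`: recursion with all signs plus, nonnegativity, zero transfer -/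

/-- **The Lieb–Sahi recursion for the signed weight**, indicator families: `E^{σ}(1_X; 1_V) = Σ_l E^{σ}(1_{V with V_l ∩ X}) − E^{σ}(1_V)·E^{σ}(1_X)`.
[folklore; LiebSahi2021 Prop. 3.3] -/
theorem sahiE_signedWeight_cons (p : ι → unitInterval) (e : ι) {k : ℕ} (X : Set (Set ι)) (V : Fin (k + 1) → Set (Set ι)) :
    sahiE (bernoulliWeight p - bernoulliWeight (update p e 1)) (k + 2) (Matrix.vecCons (ind X) (fun j => ind (V j))) =
      (∑ l : Fin (k + 1), sahiE (bernoulliWeight p - bernoulliWeight (update p e 1)) (k + 1) (fun j => ind (update V l (V l ∩ X) j))) -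
        sahiE (bernoulliWeight p - bernoulliWeight (update p e 1)) (k + 1) (fun j => ind (V j)) *
          ex (bernoulliWeight p - bernoulliWeight (update p e 1)) (ind X) := by
  rw [sahiE_cons]
  simp only [update_ind_mul_ind]

/-- **`W_p(V) ≥ 0`**: for every family of INCREASING events and every `p` in the closed cube, `E_k(μ_p − μ_{p[e↦1]}; 1_V) ≤ 0`. [this work] -/
theorem sahiE_signedWeight_nonpos (p : ι → unitInterval) (e : ι) :
    ∀ {k : ℕ} (V : Fin k → Set (Set ι)), (∀ j, IsUpperSet (V j)) →
      sahiE (bernoulliWeight p - bernoulliWeight (update p e 1)) k (fun j => ind (V j)) ≤ 0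
  | 0, V, _ => by rw [sahiE_zero]
  | 1, V, hV => by rw [sahiE_one_apply]; exact ex_ind_signedWeight_nonpos p e (hV 0)
  | k + 2, V, hV => by
    have hcons : (fun j => ind (V j)) = Matrix.vecCons (ind (V 0)) (fun j => ind (Fin.tail V j)) := by
      funext j; refine Fin.cases ?_ (fun j' => ?_) j <;> simp [Fin.tail]
    rw [hcons, sahiE_signedWeight_cons]
    have hT : ∀ j, IsUpperSet (Fin.tail V j) := fun j => hV j.succ
    refine sub_nonpos.mpr (le_trans (Finset.sum_nonpos fun l _ =>
      sahiE_signedWeight_nonpos p e _ (isUpperSet_update_inter hT l (hV 0))) ?_)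
    exact mul_nonneg_of_nonpos_of_nonpos (sahiE_signedWeight_nonpos p e _ hT) (ex_ind_signedWeight_nonpos p e (hV 0))

/-- **Zero transfer for `W_p(V)`**: for increasing events, a zero of `E_k(μ_p − μ_{p[e↦1]}; 1_V)` at one interior `p` is a zero at every `q`.
[this work] -/
theorem sahiE_signedWeight_eq_zero_transfer {p : ι → unitInterval} (hp : ∀ i, (p i : ℝ) ∈ Set.Ioo (0 : ℝ) 1) (q : ι → unitInterval) (e : ι) :
    ∀ {k : ℕ} (V : Fin k → Set (Set ι)), (∀ j, IsUpperSet (V j)) →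
      sahiE (bernoulliWeight p - bernoulliWeight (update p e 1)) k (fun j => ind (V j)) = 0 →
        sahiE (bernoulliWeight q - bernoulliWeight (update q e 1)) k (fun j => ind (V j)) = 0
  | 0, V, _, _ => by rw [sahiE_zero]
  | 1, V, hV, h => by
    rw [sahiE_one_apply] at h ⊢
    exact ex_ind_signedWeight_eq_zero_transfer hp q e (hV 0) h
  | k + 2, V, hV, h => by
    have hcons : (fun j => ind (V j)) = Matrix.vecCons (ind (V 0)) (fun j => ind (Fin.tail V j)) := by
      funext j; refine Fin.cases ?_ (fun j' => ?_) j <;> simp [Fin.tail]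
    rw [hcons, sahiE_signedWeight_cons] at h ⊢
    have hT : ∀ j, IsUpperSet (Fin.tail V j) := fun j => hV j.succ
    -- at `p`: a sum of nonpositive terms minus a nonnegative product vanishes, so every piece vanishes
    have hterms : ∀ l ∈ (univ : Finset (Fin (k + 1))),
        sahiE (bernoulliWeight p - bernoulliWeight (update p e 1)) (k + 1) (fun j => ind (update (Fin.tail V) l (Fin.tail V l ∩ V 0) j)) ≤ 0 :=
      fun l _ => sahiE_signedWeight_nonpos p e _ (isUpperSet_update_inter hT l (hV 0))
    have hprod : 0 ≤ sahiE (bernoulliWeight p - bernoulliWeight (update p e 1)) (k + 1) (fun j => ind (Fin.tail V j)) *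
        ex (bernoulliWeight p - bernoulliWeight (update p e 1)) (ind (V 0)) :=
      mul_nonneg_of_nonpos_of_nonpos (sahiE_signedWeight_nonpos p e _ hT) (ex_ind_signedWeight_nonpos p e (hV 0))
    have hsum_le : ∑ l : Fin (k + 1),
        sahiE (bernoulliWeight p - bernoulliWeight (update p e 1)) (k + 1) (fun j => ind (update (Fin.tail V) l (Fin.tail V l ∩ V 0) j)) ≤ 0 :=
      Finset.sum_nonpos hterms
    have hsum0 : ∑ l : Fin (k + 1),
        sahiE (bernoulliWeight p - bernoulliWeight (update p e 1)) (k + 1) (fun j => ind (update (Fin.tail V) l (Fin.tail V l ∩ V 0) j)) = 0 := by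
      linarith
    have hprod0 : sahiE (bernoulliWeight p - bernoulliWeight (update p e 1)) (k + 1) (fun j => ind (Fin.tail V j)) *
        ex (bernoulliWeight p - bernoulliWeight (update p e 1)) (ind (V 0)) = 0 := by linarith
    have heach := (Finset.sum_eq_zero_iff_of_nonpos hterms).1 hsum0
    rw [Finset.sum_eq_zero fun l hl => sahiE_signedWeight_eq_zero_transfer hp q e _ (isUpperSet_update_inter hT l (hV 0)) (heach l hl),
      zero_sub, neg_eq_zero]
    rcases mul_eq_zero.mp hprod0 with h1 | h1
    · rw [sahiE_signedWeight_eq_zero_transfer hp q e _ hT h1, zero_mul]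
    · rw [ex_ind_signedWeight_eq_zero_transfer hp q e (hV 0) h1, mul_zero]

/-! ### The section expansion -/

/-- **One-coordinate expansion around the `1`-section, every order.**  For any family of events `U` and any `p` in the closed cube:
`E_n(μ_p;1_U) = E_n(μ_p;1_{U¹}) + E_n(σ;1_U) − Σ_A E_{|A|}(σ;1_{U_A})·E_{n−|A|}(μ_p;1_{(U¹)_{Aᶜ}})`, `σ = μ_p − μ_{p[e↦1]}`, `X¹ = secAt e true X`.
[this work] -/
theorem sahiE_ind_section_expansion (p : ι → unitInterval) (e : ι) {n : ℕ} (U : Fin n → Set (Set ι)) :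
    sahiE (bernoulliWeight p) n (fun j => ind (U j)) =
      sahiE (bernoulliWeight p) n (fun j => ind (secAt e true (U j))) +
        sahiE (bernoulliWeight p - bernoulliWeight (update p e 1)) n (fun j => ind (U j)) -
        ∑ A : Finset (Fin n),
          sahiE (bernoulliWeight p - bernoulliWeight (update p e 1)) A.card (fun j => ind (U (A.orderEmbOfFin rfl j))) *
            sahiE (bernoulliWeight p) Aᶜ.card (fun j => ind (secAt e true (U (Aᶜ.orderEmbOfFin rfl j)))) := by
  have h := WeightSum.sahiE_add_weight (bernoulliWeight p - bernoulliWeight (update p e 1)) (bernoulliWeight (update p e 1)) n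
    (fun j => ind (U j))
  rw [sub_add_cancel] at h
  rw [h]
  simp only [sahiE_ind_update_one]
  ring

end Pinning

end Summit.CriticalPhenomena.PercolationContinuityZ3.Theorems
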